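import Mathlib
import Summits.NavierStokesRegularity.NavierStokesRegularity.Theorems.EulerZoomLiouvillePowerGaugeEulerLiouvilleCondenserWeightedQuietSliceShell

/-!
# (Q‴) THE `s²`-WEIGHTED QUIET SLICE WITH TWO BALL FUNCTIONALS — plate t50-Q‴ of nsreg-p2 ROUND-47 «WHO HOLDS THE
RIDGE» (`r47/Sketch47.lean` sha16 c5b0bf755040b563, text VERBATIM)

Width piece for crux `EulerZoomLiouville.PowerGaugeEulerLiouville` (stmt-NavierStokesRegularity-19832), by name under
LEAD 19832 (ns-typeII-p2 g14) and planner nsreg-p2 g37; seat ns-ezl-w2 g5,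
`--supports stmt-NavierStokesRegularity-19832 --as helper`.

It is t48-Q″ (`Condenser.weightedQuietSliceShell_of`, ns-sfl-p1 g7, p678007) with the ball functional `F` replaced by a
PAIR `(F₁, F₂)` and Markov run for both: `F₁, F₂, G ≥ 0` continuous, `∫_{B(0,R')} Fᵢ ≤ Xᵢ`,
`∫_{B(0,R') ∩ {ℓ₁ ≤ x₂}} G ≤ Y`, `0 < ℓ₁ < ℓ₂`, `0 < η < 1` ⇒ some height `s ∈ [ℓ₁, ℓ₂]` has
`∫ 𝟙_{B(0,R')}Fᵢ ∘ plane s ≤ 2Xᵢ/(η(ℓ₂−ℓ₁))` (`i = 1, 2`) AND `∫ 𝟙_{B(0,R')}G ∘ plane s ≤ 3Y s²/((ℓ₁+(1−η)(ℓ₂−ℓ₁))³ − ℓ₁³)`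
(factor `2` in the `F`-constants, the `G`-constant unchanged).
Proof: apply Q″ to `F := F₁/X₁ + F₂/X₂` (ball budget `≤ 2`) and read the two slice bounds off `Fᵢ ≤ Xᵢ F`; the slice
function `a ↦ 𝟙_{B(0,R')}F(plane s a)` of a continuous `F` is integrable at EVERY height (`integrable_indicator_ball_plane`,
bounded support `⊆ B̄(0,R')` since `‖a‖ ≤ ‖plane s a‖`).
Use in ROUND-47: `F₁ = ‖V‖²` (return + circle-mean smallness as in K″), `F₂ = |P′ − P′(0)|` (pressure normalisation),
`G = ‖DV‖_F²`.

HONEST FRAMING: measure theory on coordinate slices of `ℝ³`; nothing here proves the crux E (19832 OPEN), any door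
Target, THEOREM K⁗, or any Navier–Stokes statement; MODEL lattice only. [folklore (Markov, bathtub principle)]
-/

noncomputable section

open Set Filter Topology Metric Function MeasureTheory Real

set_option linter.dupNamespace false

namespace Summit.NavierStokesRegularity.NavierStokesRegularity.Theorems.PowerGaugeEulerLiouville.Condenser

/-! ## Slices of a truncated continuous function are integrable at every height -/

/-- The slicing map `plane s : ℝ² → ℝ³` is continuous. [folklore] -/
theorem continuous_plane (s : ℝ) : Continuous (plane s) := by
  refine (PiLp.continuous_toLp 2 _).comp ?_
  refine continuous_pi fun i => ?_
  fin_cases i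
  · exact PiLp.continuous_apply 2 _ 0
  · exact PiLp.continuous_apply 2 _ 1
  · exact continuous_const

/-- `‖a‖ ≤ ‖plane s a‖` (the slice point has the extra coordinate `s`). [folklore] -/
theorem norm_le_norm_plane (s : ℝ) (a : EuclideanSpace ℝ (Fin 2)) : ‖a‖ ≤ ‖plane s a‖ := by
  have h2 : ‖a‖ ^ 2 ≤ ‖plane s a‖ ^ 2 := by
    rw [EuclideanSpace.norm_sq_eq, EuclideanSpace.norm_sq_eq, Fin.sum_univ_two, Fin.sum_univ_three]
    simp [plane]
    nlinarith [sq_nonneg s]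
  exact le_of_pow_le_pow_left₀ two_ne_zero (norm_nonneg _) h2

/-- **Slice integrability at every height**: for continuous `Φ` on `ℝ³` and any `r, s`, the slice function
`a ↦ 𝟙_{B(0,r)} Φ (plane s a)` is integrable on `ℝ²` (it is `𝟙_{(plane s)⁻¹B(0,r)} (Φ ∘ plane s)`, a continuous function
truncated to a bounded measurable set `⊆ B̄(0,r)`). [folklore] -/
theorem integrable_indicator_ball_plane {Φ : EuclideanSpace ℝ (Fin 3) → ℝ} (hΦ : Continuous Φ) (r s : ℝ) :
    Integrable fun a : EuclideanSpace ℝ (Fin 2) => (ball (0 : EuclideanSpace ℝ (Fin 3)) r).indicator Φ (plane s a) := by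
  have hc := continuous_plane s
  have heq : (fun a : EuclideanSpace ℝ (Fin 2) => (ball (0 : EuclideanSpace ℝ (Fin 3)) r).indicator Φ (plane s a)) =
      (plane s ⁻¹' ball (0 : EuclideanSpace ℝ (Fin 3)) r).indicator (Φ ∘ plane s) := by
    funext a; rw [← indicator_comp_right]
  have hsub : plane s ⁻¹' ball (0 : EuclideanSpace ℝ (Fin 3)) r ⊆ closedBall (0 : EuclideanSpace ℝ (Fin 2)) r := by
    intro a ha
    rw [mem_preimage, mem_ball, dist_zero_right] at ha
    rw [mem_closedBall, dist_zero_right]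
    exact (norm_le_norm_plane s a).trans ha.le
  rw [heq, integrable_indicator_iff (measurableSet_ball.preimage hc.measurable)]
  exact ((hΦ.comp hc).continuousOn.integrableOn_compact (isCompact_closedBall _ r)).mono_set hsub

/-! ## The weighted quiet slice with two ball functionals -/

/-- **(Q‴) THE `s²`-WEIGHTED QUIET SLICE WITH TWO BALL FUNCTIONALS**, working form.  See the module docstring.
[folklore (Markov, bathtub principle)] -/
theorem weightedQuietSliceShell2_of {F₁ F₂ G : EuclideanSpace ℝ (Fin 3) → ℝ} (hF₁c : Continuous F₁)
    (hF₂c : Continuous F₂) (hGc : Continuous G) (hF₁0 : ∀ x, 0 ≤ F₁ x) (hF₂0 : ∀ x, 0 ≤ F₂ x) (hG0 : ∀ x, 0 ≤ G x)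
    {ℓ₁ ℓ₂ R' η X₁ X₂ Y : ℝ} (hℓ₁ : 0 < ℓ₁) (hℓ : ℓ₁ < ℓ₂) (hη : 0 < η) (hη1 : η < 1) (hX₁ : 0 < X₁) (hX₂ : 0 < X₂)
    (hY : 0 < Y)
    (hFX₁ : ∫ x in ball (0 : EuclideanSpace ℝ (Fin 3)) R', F₁ x ≤ X₁)
    (hFX₂ : ∫ x in ball (0 : EuclideanSpace ℝ (Fin 3)) R', F₂ x ≤ X₂)
    (hGY : ∫ x in ball (0 : EuclideanSpace ℝ (Fin 3)) R' ∩ {x | ℓ₁ ≤ x 2}, G x ≤ Y) :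
    ∃ s ∈ Icc ℓ₁ ℓ₂,
      ∫ a, (ball (0 : EuclideanSpace ℝ (Fin 3)) R').indicator F₁ (plane s a) ≤ 2 * X₁ / (η * (ℓ₂ - ℓ₁)) ∧
      ∫ a, (ball (0 : EuclideanSpace ℝ (Fin 3)) R').indicator F₂ (plane s a) ≤ 2 * X₂ / (η * (ℓ₂ - ℓ₁)) ∧
      ∫ a, (ball (0 : EuclideanSpace ℝ (Fin 3)) R').indicator G (plane s a) ≤
        3 * Y / ((ℓ₁ + (1 - η) * (ℓ₂ - ℓ₁)) ^ 3 - ℓ₁ ^ 3) * s ^ 2 := by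
  -- the combined functional
  set F : EuclideanSpace ℝ (Fin 3) → ℝ := fun x => X₁⁻¹ * F₁ x + X₂⁻¹ * F₂ x with hF
  have hFc : Continuous F := (continuous_const.mul hF₁c).add (continuous_const.mul hF₂c)
  have hF0 : ∀ x, 0 ≤ F x := fun x =>
    add_nonneg (mul_nonneg (inv_nonneg.2 hX₁.le) (hF₁0 x)) (mul_nonneg (inv_nonneg.2 hX₂.le) (hF₂0 x))
  have hball : ∀ {Φ : EuclideanSpace ℝ (Fin 3) → ℝ}, Continuous Φ →
      IntegrableOn Φ (ball (0 : EuclideanSpace ℝ (Fin 3)) R') := fun hΦ =>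
    (hΦ.continuousOn.integrableOn_compact (isCompact_closedBall 0 R')).mono_set ball_subset_closedBall
  have hFX : ∫ x in ball (0 : EuclideanSpace ℝ (Fin 3)) R', F x ≤ 2 := by
    have e : ∫ x in ball (0 : EuclideanSpace ℝ (Fin 3)) R', F x =
        X₁⁻¹ * (∫ x in ball (0 : EuclideanSpace ℝ (Fin 3)) R', F₁ x) +
          X₂⁻¹ * ∫ x in ball (0 : EuclideanSpace ℝ (Fin 3)) R', F₂ x := by
      rw [hF, integral_add ((hball hF₁c).const_mul _) ((hball hF₂c).const_mul _), integral_const_mul,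
        integral_const_mul]
    have h1 : X₁⁻¹ * (∫ x in ball (0 : EuclideanSpace ℝ (Fin 3)) R', F₁ x) ≤ 1 := by
      rw [inv_mul_le_iff₀ hX₁, mul_one]; exact hFX₁
    have h2 : X₂⁻¹ * (∫ x in ball (0 : EuclideanSpace ℝ (Fin 3)) R', F₂ x) ≤ 1 := by
      rw [inv_mul_le_iff₀ hX₂, mul_one]; exact hFX₂
    rw [e]; linarith
  obtain ⟨s, hs, hFs, hGs⟩ :=
    weightedQuietSliceShell_of hFc hGc hF0 hG0 hℓ₁ hℓ hη hη1 (by norm_num : (0 : ℝ) < 2) hY hFX hGY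
  have hint : Integrable fun a : EuclideanSpace ℝ (Fin 2) =>
      (ball (0 : EuclideanSpace ℝ (Fin 3)) R').indicator F (plane s a) := integrable_indicator_ball_plane hFc R' s
  -- reading off the slice bound of one summand
  have hread : ∀ {Φ : EuclideanSpace ℝ (Fin 3) → ℝ} {X : ℝ}, (∀ x, 0 ≤ Φ x) → 0 < X → (∀ x, Φ x ≤ X * F x) →
      ∫ a, (ball (0 : EuclideanSpace ℝ (Fin 3)) R').indicator Φ (plane s a) ≤ 2 * X / (η * (ℓ₂ - ℓ₁)) := by
    intro Φ X hΦ0 hX hΦF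
    have hle : ∫ a, (ball (0 : EuclideanSpace ℝ (Fin 3)) R').indicator Φ (plane s a) ≤
        ∫ a, X * (ball (0 : EuclideanSpace ℝ (Fin 3)) R').indicator F (plane s a) := by
      refine integral_mono_of_nonneg (ae_of_all _ fun a => Set.indicator_nonneg (fun x _ => hΦ0 x) _)
        (hint.const_mul X) (ae_of_all _ fun a => ?_)
      by_cases hm : plane s a ∈ ball (0 : EuclideanSpace ℝ (Fin 3)) R'
      · simp only [indicator_of_mem hm]; exact hΦF _
      · simp only [indicator_of_notMem hm, mul_zero]; exact le_rfl
    rw [integral_const_mul] at hle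
    calc ∫ a, (ball (0 : EuclideanSpace ℝ (Fin 3)) R').indicator Φ (plane s a)
        ≤ X * ∫ a, (ball (0 : EuclideanSpace ℝ (Fin 3)) R').indicator F (plane s a) := hle
      _ ≤ X * (2 / (η * (ℓ₂ - ℓ₁))) := mul_le_mul_of_nonneg_left hFs hX.le
      _ = 2 * X / (η * (ℓ₂ - ℓ₁)) := by ring
  refine ⟨s, hs, hread hF₁0 hX₁ fun x => ?_, hread hF₂0 hX₂ fun x => ?_, hGs⟩
  · have h : 0 ≤ X₁ * (X₂⁻¹ * F₂ x) := mul_nonneg hX₁.le (mul_nonneg (inv_nonneg.2 hX₂.le) (hF₂0 x))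
    rw [hF, mul_add, ← mul_assoc, mul_inv_cancel₀ hX₁.ne', one_mul]
    linarith
  · have h : 0 ≤ X₂ * (X₁⁻¹ * F₁ x) := mul_nonneg hX₂.le (mul_nonneg (inv_nonneg.2 hX₁.le) (hF₁0 x))
    rw [hF, mul_add, ← mul_assoc X₂ X₂⁻¹, mul_inv_cancel₀ hX₂.ne', one_mul]
    linarith

/-- **(Q‴) `NsregP2.R47.WeightedQuietSliceShell2`, binder-for-binder** (Sketch47 of nsreg-p2 g37, plate t50-Q‴; `E3`
written out, `Condenser.plane`). [folklore (Markov, bathtub principle)] -/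
theorem weightedQuietSliceShell2 :
    ∀ (F₁ F₂ G : EuclideanSpace ℝ (Fin 3) → ℝ), Continuous F₁ → Continuous F₂ → Continuous G →
      (∀ x, 0 ≤ F₁ x) → (∀ x, 0 ≤ F₂ x) → (∀ x, 0 ≤ G x) →
      ∀ (ℓ₁ ℓ₂ R' η X₁ X₂ Y : ℝ), 0 < ℓ₁ → ℓ₁ < ℓ₂ → 0 < η → η < 1 → 0 < X₁ → 0 < X₂ → 0 < Y →
        (∫ x in ball (0 : EuclideanSpace ℝ (Fin 3)) R', F₁ x ≤ X₁) →
        (∫ x in ball (0 : EuclideanSpace ℝ (Fin 3)) R', F₂ x ≤ X₂) →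
        (∫ x in ball (0 : EuclideanSpace ℝ (Fin 3)) R' ∩ {x : EuclideanSpace ℝ (Fin 3) | ℓ₁ ≤ x 2}, G x ≤ Y) →
        ∃ s ∈ Icc ℓ₁ ℓ₂,
          ∫ a, (ball (0 : EuclideanSpace ℝ (Fin 3)) R').indicator F₁ (Condenser.plane s a) ≤
              2 * X₁ / (η * (ℓ₂ - ℓ₁)) ∧
          ∫ a, (ball (0 : EuclideanSpace ℝ (Fin 3)) R').indicator F₂ (Condenser.plane s a) ≤
              2 * X₂ / (η * (ℓ₂ - ℓ₁)) ∧
          ∫ a, (ball (0 : EuclideanSpace ℝ (Fin 3)) R').indicator G (Condenser.plane s a) ≤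
            3 * Y / ((ℓ₁ + (1 - η) * (ℓ₂ - ℓ₁)) ^ 3 - ℓ₁ ^ 3) * s ^ 2 :=
  fun _ _ _ hF₁c hF₂c hGc hF₁0 hF₂0 hG0 _ _ _ _ _ _ _ hℓ₁ hℓ hη hη1 hX₁ hX₂ hY hFX₁ hFX₂ hGY =>
    weightedQuietSliceShell2_of hF₁c hF₂c hGc hF₁0 hF₂0 hG0 hℓ₁ hℓ hη hη1 hX₁ hX₂ hY hFX₁ hFX₂ hGY

end Summit.NavierStokesRegularity.NavierStokesRegularity.Theorems.PowerGaugeEulerLiouville.Condenser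

end
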